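import Literature.MathematicalPhysics.QuantumLattice.HubbardMatsubaraShellGram
import Literature.MathematicalPhysics.QuantumLattice.HubbardMatsubaraCutoffEffAction
import Literature.MathematicalPhysics.QuantumLattice.HubbardGridSymbolCharSums
import Literature.MathematicalPhysics.QuantumLattice.TorusCooperSum
import HarnessLib

/-!
# The decay constant of the Matsubara shell covariance on the time grid: row and column sums are `O(β/√M)`, uniformly in `M″`

Topic `MathematicalPhysics/QuantumLattice`; continuation of `HubbardMatsubaraShellGram` (normal form, Gram constant `κ_S`, entry bound of the
shell covariance `S` between cutoffs `M ≤ M″`) — here the third input of the determinant-bounded single-scale step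
(`GrassmannEffectiveActionTruncationDB.sum_norm_kernel_effAction_sub_gaussConv_le_of_gramBounded`, hypotheses `hrow`/`hcol`): the row and
column sums of `S` pulled back to the `N`-point time grid (`hubbardGridSub L M″ β N`, `2M″ ≤ N`).  Below the shell floor `Λ ≤ π(2M+1)/β` the
shell symbol is `βL²·[n ∈ shell]/(−iω + e_K)`, and

  `1/(−iω+e) = i/ω + e/ω² − (e²/ω²)/(e − iω)`   (`ω ≠ 0`)

splits it into (T1) a momentum-independent piece (`δ` in space, Plancherel in time: `Σ_shell ω⁻²`), (T2) a product piece (the position kernel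
of the renormalised band `e_K`, `ℓ¹ ≤ 4 + |μ| + coeffNorm 0 K`, times `Σ_shell ω⁻²`) and (T3) a remainder `O(E²/|ω|³)` summable crudely
(`HubbardGridSymbolCharSums`).  Result (**`rowSum_gridSub_hubbardCovShellCT_le`**, `colSum_…`), with `c_e = 4 + |μ| + coeffNorm 0 K`:

  `Σ_Y ‖(Sᵀ S S)(X,Y)‖ ≤ N/(π√(2M)) + N·β·c_e/(2π²M) + N·L²·c_e²·β²/(2π³M(2M+1))`,

i.e. times the grid weight `β/N` of the local quartic vertex (**`gridWeight_mul_rowSum_hubbardCovShellCT_le`**):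
`β/(π√(2M)) + β²c_e/(2π²M) + β³L²c_e²/(2π³M(2M+1))` — at `M ≥ 2¹⁰β²L²` every term is `O(1/L)`; UNIFORM in the outer cutoff `M″`.

Everything is proved; no definitions, no named facts.

## Sources

W. de S. Pedra, M. Salmhofer, Commun. Math. Phys. 282 (2008) 797–818, §5 Lemma 5.2 (the decay constant `α` of the ultraviolet part of the
frequency split) [`PedraSalmhofer2008`]; G. Benfatto, A. Giuliani, V. Mastropietro, Ann. Henri Poincaré 7 (2006) 809–898, Lemma 2.2 (2.81)
[`BenfattoGiulianiMastropietro2006`].  The `[cite: …]` tags LOCATE the construct each statement is about; the statements are elementary.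
-/

noncomputable section

namespace Literature.MathematicalPhysics.QuantumLattice

open Finset Complex Literature.Probability.LatticeModels
open scoped ComplexConjugate

variable {L : ℕ} [NeZero L] {M M'' N : ℕ}

/-! ### §1 The shell symbol below the floor and its three pieces -/

/-- **The partial-fraction split of the free propagator symbol**: `1/(−iω+e) = i/ω + e/ω² − (e²/ω²)/(e − iω)` (`ω ≠ 0`).
[cite: PedraSalmhofer2008, §5 Lemma 5.2] -/
theorem one_div_uvDen_eq_three (e : ℝ) {ω : ℝ} (hω : ω ≠ 0) :
    (1 : ℂ) / (-I * ω + e) = I / ω + ((e / ω ^ 2 : ℝ) : ℂ) - ((e ^ 2 / ω ^ 2 : ℝ) : ℂ) / ((e : ℂ) - I * ω) := by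
  have hω' : (ω : ℂ) ≠ 0 := by exact_mod_cast hω
  have hd : ((e : ℂ) - I * ω) ≠ 0 := by
    intro h0
    have := congrArg Complex.im h0
    simp at this
    exact hω this
  rw [show (-I * (ω : ℂ) + e) = ((e : ℂ) - I * ω) by ring]
  push_cast
  field_simp
  ring_nf
  rw [I_sq]
  ring

/-- **Below the shell floor the shell symbol is `βL²/(−iω + e_K)` on the shell** (weight `1`; `0 < β`, `0 < Λ ≤ π(2M+1)/β`).
[cite: PedraSalmhofer2008, §5 Lemma 5.2] -/
theorem shellSymbolCT_eq_of_floor {β : ℝ} (hβ : 0 < β) (h : M ≤ M'') (μ : ℝ) (K : TrigPolyC4v) {Λ : ℝ} (hΛ : 0 < Λ)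
    (hΛle : Λ ≤ Real.pi * (2 * M + 1) / β) (ks : FreqMomentum L M'' × Fin 2) (hk : ks.1.1 ∈ MatsubaraIdx.shell h) :
    shellSymbolCT L h β μ K Λ ks = ((β * (L : ℝ) ^ 2 : ℝ) : ℂ) * (1 / (-I * matsubaraFreq β M'' ks.1.1 + nambuXiCT L μ K ks.1.2)) := by
  have hks : ks.1 ∉ Set.range (FreqMomentum.emb (L := L) h) := by
    rw [FreqMomentum.mem_range_emb_iff, ← MatsubaraIdx.mem_shell_iff]; exact hk
  have hw : hubbardCutoffWeightCT L M'' β μ K Λ ks.1 = 1 := hubbardCutoffWeightCT_eq_one_of_not_mem h β μ K hβ hΛ hΛle hks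
  have hω := matsubaraFreq_ne_zero (M := M'') hβ.ne' ks.1.1
  have hden : (nambuDenCT L M'' β μ 0 K ks.1 : ℝ) = matsubaraFreq β M'' ks.1.1 ^ 2 + nambuXiCT L μ K ks.1.2 ^ 2 := by
    simp [nambuDenCT]
  have hne : (-I * (matsubaraFreq β M'' ks.1.1 : ℂ) + nambuXiCT L μ K ks.1.2) ≠ 0 := by
    intro h0; have := congrArg Complex.im h0; simp at this; exact hω this
  have hD : (matsubaraFreq β M'' ks.1.1 : ℂ) ^ 2 + (nambuXiCT L μ K ks.1.2 : ℂ) ^ 2 ≠ 0 := by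
    have : (0 : ℝ) < matsubaraFreq β M'' ks.1.1 ^ 2 + nambuXiCT L μ K ks.1.2 ^ 2 := by positivity
    exact_mod_cast this.ne'
  rw [shellSymbolCT_of_mem h β μ K Λ hk, uvSymbolCT, hw, hden]
  push_cast
  rw [one_mul]
  congr 1
  rw [div_eq_div_iff hD hne, one_mul]
  ring_nf
  rw [I_sq]
  ring

section Pieces

variable (L) (h : M ≤ M'') (β μ : ℝ) (K : TrigPolyC4v)

/-- (T1) the momentum-independent piece `[shell]·βL²·i/ω`. [folklore] -/
private def pieceT1 (i : MatsubaraIdx M'') : ℂ :=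
  if i ∈ MatsubaraIdx.shell h then ((β * (L : ℝ) ^ 2 : ℝ) : ℂ) * (I / matsubaraFreq β M'' i) else 0

/-- (T2) the time factor `[shell]·βL²/ω²` of the product piece. [folklore] -/
private def pieceT2 (i : MatsubaraIdx M'') : ℂ :=
  if i ∈ MatsubaraIdx.shell h then ((β * (L : ℝ) ^ 2 / matsubaraFreq β M'' i ^ 2 : ℝ) : ℂ) else 0

/-- (T3) the remainder `−[shell]·βL²·(e²/ω²)/(e − iω)`. [folklore] -/
private def pieceT3 (ks : FreqMomentum L M'' × Fin 2) : ℂ :=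
  if ks.1.1 ∈ MatsubaraIdx.shell h then
    -(((β * (L : ℝ) ^ 2 : ℝ) : ℂ) * (((nambuXiCT L μ K ks.1.2 ^ 2 / matsubaraFreq β M'' ks.1.1 ^ 2 : ℝ) : ℂ) /
      ((nambuXiCT L μ K ks.1.2 : ℂ) - I * matsubaraFreq β M'' ks.1.1))) else 0

end Pieces

/-- **The three-piece decomposition of the shell symbol below the floor.** [cite: PedraSalmhofer2008, §5 Lemma 5.2] -/
theorem shellSymbolCT_eq_pieces {β : ℝ} (hβ : 0 < β) (h : M ≤ M'') (μ : ℝ) (K : TrigPolyC4v) {Λ : ℝ} (hΛ : 0 < Λ)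
    (hΛle : Λ ≤ Real.pi * (2 * M + 1) / β) :
    shellSymbolCT L h β μ K Λ =
      (fun ks => pieceT1 L h β ks.1.1) + (fun ks => pieceT2 L h β ks.1.1 * (nambuXiCT L μ K ks.1.2 : ℂ)) + pieceT3 L h β μ K := by
  funext ks
  simp only [Pi.add_apply, pieceT1, pieceT2, pieceT3]
  by_cases hk : ks.1.1 ∈ MatsubaraIdx.shell h
  · rw [shellSymbolCT_eq_of_floor hβ h μ K hΛ hΛle ks hk, if_pos hk, if_pos hk, if_pos hk,
      one_div_uvDen_eq_three _ (matsubaraFreq_ne_zero (M := M'') hβ.ne' ks.1.1)]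
    push_cast
    have hω : (matsubaraFreq β M'' ks.1.1 : ℂ) ≠ 0 := by exact_mod_cast matsubaraFreq_ne_zero (M := M'') hβ.ne' ks.1.1
    field_simp
    ring
  · rw [shellSymbolCT_of_not_mem h β μ K Λ hk, if_neg hk, if_neg hk, if_neg hk]
    simp

/-! ### §2 The sizes of the pieces -/

omit [NeZero L] in
/-- `Σ_i ‖T1 i‖² = (βL²)²·Σ_shell 1/ω² ≤ (βL²)²·β²/(2π²M)`. [cite: PedraSalmhofer2008, §5 Lemma 5.2] -/
theorem sum_norm_sq_pieceT1_le {β : ℝ} (hβ : 0 < β) (hM : 1 ≤ M) (h : M ≤ M'') :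
    ∑ i : MatsubaraIdx M'', ‖pieceT1 L h β i‖ ^ 2 ≤ (β * (L : ℝ) ^ 2) ^ 2 * (β ^ 2 / (2 * Real.pi ^ 2 * M)) := by
  classical
  have hpt : ∀ i : MatsubaraIdx M'', ‖pieceT1 L h β i‖ ^ 2 =
      if i ∈ MatsubaraIdx.shell h then (β * (L : ℝ) ^ 2) ^ 2 * (1 / matsubaraFreq β M'' i ^ 2) else 0 := by
    intro i
    rw [pieceT1]
    split_ifs
    · rw [norm_mul, Complex.norm_real, Real.norm_of_nonneg (by positivity), norm_div, Complex.norm_I, Complex.norm_real,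
        Real.norm_eq_abs, mul_pow, div_pow, one_pow, sq_abs]
    · rw [norm_zero]; ring
  simp_rw [hpt]
  rw [Finset.sum_ite_mem, Finset.univ_inter, ← mul_sum]
  exact mul_le_mul_of_nonneg_left (sum_shell_one_div_sq_le hβ hM h) (by positivity)

omit [NeZero L] in
/-- `Σ_i ‖T2 i‖ = βL²·Σ_shell 1/ω² ≤ βL²·β²/(2π²M)`. [cite: PedraSalmhofer2008, §5 Lemma 5.2] -/
theorem sum_norm_pieceT2_le {β : ℝ} (hβ : 0 < β) (hM : 1 ≤ M) (h : M ≤ M'') :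
    ∑ i : MatsubaraIdx M'', ‖pieceT2 L h β i‖ ≤ β * (L : ℝ) ^ 2 * (β ^ 2 / (2 * Real.pi ^ 2 * M)) := by
  classical
  have hpt : ∀ i : MatsubaraIdx M'', ‖pieceT2 L h β i‖ =
      if i ∈ MatsubaraIdx.shell h then β * (L : ℝ) ^ 2 * (1 / matsubaraFreq β M'' i ^ 2) else 0 := by
    intro i
    rw [pieceT2]
    split_ifs
    · rw [Complex.norm_real, Real.norm_of_nonneg (by positivity), mul_one_div]
    · rw [norm_zero]
  simp_rw [hpt]
  rw [Finset.sum_ite_mem, Finset.univ_inter, ← mul_sum]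
  exact mul_le_mul_of_nonneg_left (sum_shell_one_div_sq_le hβ hM h) (by positivity)

omit [NeZero L] in
/-- `|e_K(k⃗)| ≤ 4 + |μ| + coeffNorm 0 K`. [cite: BenfattoGiulianiMastropietro2006, §2.1 (2.3)] -/
theorem abs_nambuXiCT_le (μ : ℝ) (K : TrigPolyC4v) (kv : TorusSite 2 L) : |nambuXiCT L μ K kv| ≤ 4 + |μ| + K.coeffNorm 0 := by
  rw [nambuXiCT]
  have h1 : |torusBand L kv| ≤ 4 := by have := abs_torusBand_le L kv; norm_num at this; exact this
  have h2 := TrigPolyC4v.abs_eval_le_coeffNorm K (latticeMomentum L kv)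
  calc |torusBand L kv - μ - K.eval (latticeMomentum L kv)| ≤ |torusBand L kv - μ| + |K.eval (latticeMomentum L kv)| := abs_sub _ _
    _ ≤ |torusBand L kv| + |μ| + |K.eval (latticeMomentum L kv)| := by linarith [abs_sub (torusBand L kv) μ]
    _ ≤ _ := by linarith

omit [NeZero L] in
/-- `‖T3 (k,σ)‖ ≤ [shell]·βL²·c_e²·(1/ω²)·(1/|ω|)`, `c_e = 4 + |μ| + coeffNorm 0 K`. [cite: PedraSalmhofer2008, §5 Lemma 5.2] -/
theorem norm_pieceT3_le {β : ℝ} (hβ : 0 < β) (h : M ≤ M'') (μ : ℝ) (K : TrigPolyC4v) (ks : FreqMomentum L M'' × Fin 2) :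
    ‖pieceT3 L h β μ K ks‖ ≤
      if ks.1.1 ∈ MatsubaraIdx.shell h then
        β * (L : ℝ) ^ 2 * ((4 + |μ| + K.coeffNorm 0) ^ 2 * (1 / matsubaraFreq β M'' ks.1.1 ^ 2) * (1 / |matsubaraFreq β M'' ks.1.1|))
      else 0 := by
  rw [pieceT3]
  split_ifs with hk
  · have hω := matsubaraFreq_ne_zero (M := M'') hβ.ne' ks.1.1
    set ω := matsubaraFreq β M'' ks.1.1
    set e := nambuXiCT L μ K ks.1.2
    have he := abs_nambuXiCT_le μ K ks.1.2
    have hd : |ω| ≤ ‖(e : ℂ) - I * ω‖ := by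
      rw [show (e : ℂ) - I * ω = ((e : ℝ) : ℂ) + ((-ω : ℝ) : ℂ) * I by push_cast; ring, Complex.norm_add_mul_I, ← Real.sqrt_sq_eq_abs]
      exact Real.sqrt_le_sqrt (by nlinarith [sq_nonneg e])
    have hd0 : 0 < ‖(e : ℂ) - I * ω‖ := lt_of_lt_of_le (abs_pos.2 hω) hd
    rw [norm_neg, norm_mul, Complex.norm_real, Real.norm_of_nonneg (by positivity), norm_div, Complex.norm_real, Real.norm_of_nonneg
      (by positivity)]
    refine mul_le_mul_of_nonneg_left ?_ (by positivity)
    rw [div_eq_mul_one_div, div_eq_mul_one_div (e ^ 2)]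
    refine mul_le_mul ?_ (one_div_le_one_div_of_le (abs_pos.2 hω) hd) (by positivity) (by positivity)
    refine mul_le_mul_of_nonneg_right ?_ (by positivity)
    rw [← sq_abs]
    exact pow_le_pow_left₀ (abs_nonneg _) he 2
  · rw [norm_zero]

/-- `Σ_k ‖T3 (k,σ)‖ ≤ L²·βL²·c_e²·(β/(π(2M+1)))·(β²/(2π²M))`. [cite: PedraSalmhofer2008, §5 Lemma 5.2] -/
theorem sum_norm_pieceT3_le {β : ℝ} (hβ : 0 < β) (hM : 1 ≤ M) (h : M ≤ M'') (μ : ℝ) (K : TrigPolyC4v) (σ : Fin 2) :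
    ∑ k : FreqMomentum L M'', ‖pieceT3 L h β μ K (k, σ)‖ ≤
      (L : ℝ) ^ 2 * (β * (L : ℝ) ^ 2 * ((4 + |μ| + K.coeffNorm 0) ^ 2 * ((β / (Real.pi * (2 * M + 1))) * (β ^ 2 / (2 * Real.pi ^ 2 * M))))) := by
  classical
  set ce : ℝ := 4 + |μ| + K.coeffNorm 0 with hce
  set B : ℝ := β / (Real.pi * (2 * M + 1)) with hB
  have hB0 : 0 ≤ B := by rw [hB]; positivity
  calc ∑ k : FreqMomentum L M'', ‖pieceT3 L h β μ K (k, σ)‖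
      ≤ ∑ k : FreqMomentum L M'', (if k.1 ∈ MatsubaraIdx.shell h then
          β * (L : ℝ) ^ 2 * (ce ^ 2 * (1 / matsubaraFreq β M'' k.1 ^ 2) * B) else 0) := by
        refine sum_le_sum fun k _ => (norm_pieceT3_le hβ h μ K (k, σ)).trans ?_
        dsimp only
        split_ifs with hk
        · have hsup := one_div_abs_matsubaraFreq_le_of_mem_shell hβ h hk
          rw [hB]
          gcongr
        · exact le_rfl
    _ = ∑ kv : TorusSite 2 L, ∑ i ∈ MatsubaraIdx.shell h, β * (L : ℝ) ^ 2 * (ce ^ 2 * (1 / matsubaraFreq β M'' i ^ 2) * B) := by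
        rw [Fintype.sum_prod_type, sum_comm]
        refine sum_congr rfl fun kv _ => ?_
        dsimp only
        rw [Finset.sum_ite_mem, Finset.univ_inter]
    _ = (L : ℝ) ^ 2 * ((β * (L : ℝ) ^ 2 * (ce ^ 2 * B)) * ∑ i ∈ MatsubaraIdx.shell h, 1 / matsubaraFreq β M'' i ^ 2) := by
        rw [sum_const, card_univ, nsmul_eq_mul]
        simp only [Fintype.card_pi, ZMod.card, prod_const, Finset.card_univ, Fintype.card_fin]
        push_cast
        congr 1
        rw [mul_sum]
        exact sum_congr rfl fun i _ => by ring
    _ ≤ (L : ℝ) ^ 2 * ((β * (L : ℝ) ^ 2 * (ce ^ 2 * B)) * (β ^ 2 / (2 * Real.pi ^ 2 * M))) := by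
        gcongr
        exact sum_shell_one_div_sq_le hβ hM h
    _ = _ := by rw [hB]; ring

/-! ### §3 The `ℓ¹` norm of the character sum of the shell symbol, and the row / column sums -/

variable [NeZero N]

/-- **The `ℓ¹` norm of the character sum of the shell symbol on the `N`-grid** (`0 < β`, `1 ≤ M ≤ M″`, `2M″ ≤ N`, `0 < Λ ≤ π(2M+1)/β`):
`≤ N/(π√(2M)) + N·β·c_e/(2π²M) + N·L²·c_e²·β²/(2π³M(2M+1))`, `c_e = 4 + |μ| + coeffNorm 0 K`. [cite: PedraSalmhofer2008, §5 Lemma 5.2] -/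
theorem sum_sum_norm_charSum_shellSymbolCT_le {β : ℝ} (hβ : 0 < β) (hM : 1 ≤ M) (h : M ≤ M'') (hN : 2 * M'' ≤ N) (μ : ℝ) (K : TrigPolyC4v)
    {Λ : ℝ} (hΛ : 0 < Λ) (hΛle : Λ ≤ Real.pi * (2 * M + 1) / β) (σ : Fin 2) :
    ∑ a : TorusSite 1 N, ∑ bv : TorusSite 2 L,
        ‖∑ q₀ : TorusSite 1 N, ∑ qv : TorusSite 2 L, torusChar q₀ a * torusChar qv bv * gridSymbol L M'' N β (shellSymbolCT L h β μ K Λ) σ q₀ qv‖ ≤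
      (N : ℝ) / (Real.pi * Real.sqrt (2 * M)) + (N : ℝ) * β * (4 + |μ| + K.coeffNorm 0) / (2 * Real.pi ^ 2 * M) +
        (N : ℝ) * (L : ℝ) ^ 2 * (4 + |μ| + K.coeffNorm 0) ^ 2 * β ^ 2 / (2 * Real.pi ^ 3 * M * (2 * M + 1)) := by
  have hL : (0 : ℝ) < L := by exact_mod_cast Nat.pos_of_ne_zero (NeZero.ne L)
  have hM0 : (0 : ℝ) < M := by exact_mod_cast hM
  set ce : ℝ := 4 + |μ| + K.coeffNorm 0 with hce
  have hce0 : 0 ≤ ce := by rw [hce]; have := TrigPolyC4v.coeffNorm_nonneg 0 K; positivity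
  -- split the symbol and the character sums
  rw [shellSymbolCT_eq_pieces hβ h μ K hΛ hΛle]
  have hsplit : ∀ (a : TorusSite 1 N) (bv : TorusSite 2 L),
      ∑ q₀ : TorusSite 1 N, ∑ qv : TorusSite 2 L, torusChar q₀ a * torusChar qv bv *
          gridSymbol L M'' N β ((fun ks => pieceT1 L h β ks.1.1) + (fun ks => pieceT2 L h β ks.1.1 * (nambuXiCT L μ K ks.1.2 : ℂ)) +
            pieceT3 L h β μ K) σ q₀ qv =
        (∑ q₀ : TorusSite 1 N, ∑ qv : TorusSite 2 L, torusChar q₀ a * torusChar qv bv * gridSymbol L M'' N β (fun ks => pieceT1 L h β ks.1.1) σ q₀ qv) +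
        (∑ q₀ : TorusSite 1 N, ∑ qv : TorusSite 2 L, torusChar q₀ a * torusChar qv bv *
            gridSymbol L M'' N β (fun ks => pieceT2 L h β ks.1.1 * (nambuXiCT L μ K ks.1.2 : ℂ)) σ q₀ qv) +
        (∑ q₀ : TorusSite 1 N, ∑ qv : TorusSite 2 L, torusChar q₀ a * torusChar qv bv * gridSymbol L M'' N β (pieceT3 L h β μ K) σ q₀ qv) := by
    intro a bv
    simp only [gridSymbol_add, mul_add, sum_add_distrib]
  simp_rw [hsplit]
  refine (sum_le_sum fun a _ => sum_le_sum fun bv _ => norm_add₃_le).trans ?_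
  simp only [sum_add_distrib]
  refine add_le_add (add_le_add ?_ ?_) ?_
  · -- (T1): δ in space, Plancherel in time
    refine (sum_sum_norm_charSum_gridSymbol_fst_le hN β (pieceT1 L h β) σ).trans ?_
    have hS := sum_norm_sq_pieceT1_le (L := L) hβ hM h
    calc (L : ℝ) ^ 2 * ((N : ℝ) * Real.sqrt ((1 / (β * (L : ℝ) ^ 2)) ^ 4 * ∑ i : MatsubaraIdx M'', ‖pieceT1 L h β i‖ ^ 2))
        ≤ (L : ℝ) ^ 2 * ((N : ℝ) * Real.sqrt ((1 / (β * (L : ℝ) ^ 2)) ^ 4 * ((β * (L : ℝ) ^ 2) ^ 2 * (β ^ 2 / (2 * Real.pi ^ 2 * M))))) := by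
          gcongr
      _ = (N : ℝ) / (Real.pi * Real.sqrt (2 * M)) := by
          have hid : (1 / (β * (L : ℝ) ^ 2)) ^ 4 * ((β * (L : ℝ) ^ 2) ^ 2 * (β ^ 2 / (2 * Real.pi ^ 2 * M))) =
              (1 / ((L : ℝ) ^ 2 * Real.pi * Real.sqrt (2 * M))) ^ 2 := by
            simp only [div_pow, one_pow, mul_pow, Real.sq_sqrt (show (0 : ℝ) ≤ 2 * M by positivity)]
            field_simp
          rw [hid, Real.sqrt_sq (by positivity)]
          field_simp
  · -- (T2): position kernel of the band × sup in time
    refine (sum_sum_norm_charSum_gridSymbol_mul_le hN β (pieceT2 L h β) (fun kv => (nambuXiCT L μ K kv : ℂ)) σ).trans ?_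
    have h2 := sum_norm_pieceT2_le (L := L) hβ hM h
    have hb := sum_norm_charSum_nambuXiCT_le (L := L) μ K
    calc (N : ℝ) * ((1 / (β * (L : ℝ) ^ 2)) ^ 2 * ∑ i : MatsubaraIdx M'', ‖pieceT2 L h β i‖) *
          ∑ bv : TorusSite 2 L, ‖∑ qv : TorusSite 2 L, torusChar qv bv * (nambuXiCT L μ K qv : ℂ)‖
        ≤ (N : ℝ) * ((1 / (β * (L : ℝ) ^ 2)) ^ 2 * (β * (L : ℝ) ^ 2 * (β ^ 2 / (2 * Real.pi ^ 2 * M)))) * ((L : ℝ) ^ 2 * ce) := by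
          gcongr
      _ = (N : ℝ) * β * ce / (2 * Real.pi ^ 2 * M) := by field_simp
  · -- (T3): crude
    refine (sum_sum_norm_charSum_gridSymbol_le_card_mul hN β (pieceT3 L h β μ K) σ).trans ?_
    have h3' := sum_norm_pieceT3_le (L := L) hβ hM h μ K σ
    calc (N : ℝ) * (L : ℝ) ^ 2 * ((1 / (β * (L : ℝ) ^ 2)) ^ 2 * ∑ k : FreqMomentum L M'', ‖pieceT3 L h β μ K (k, σ)‖)
        ≤ (N : ℝ) * (L : ℝ) ^ 2 * ((1 / (β * (L : ℝ) ^ 2)) ^ 2 *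
            ((L : ℝ) ^ 2 * (β * (L : ℝ) ^ 2 * (ce ^ 2 * ((β / (Real.pi * (2 * M + 1))) * (β ^ 2 / (2 * Real.pi ^ 2 * M))))))) := by
          gcongr
      _ = (N : ℝ) * (L : ℝ) ^ 2 * ce ^ 2 * β ^ 2 / (2 * Real.pi ^ 3 * M * (2 * M + 1)) := by
          field_simp

/-- **Row sums of the shell covariance on the time grid** (`hrow` of the determinant-bounded step for the shell integration):
`Σ_Y ‖(Sᵀ·S·S)(X,Y)‖ ≤ N/(π√(2M)) + Nβc_e/(2π²M) + NL²c_e²β²/(2π³M(2M+1))` for every grid leg `X`; UNIFORM in `M″`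
(`0 < β`, `1 ≤ M ≤ M″`, `2M″ ≤ N`, `0 < Λ ≤ π(2M+1)/β`, seed `0`). [cite: PedraSalmhofer2008, §5 Lemma 5.2] -/
theorem rowSum_gridSub_hubbardCovShellCT_le {β : ℝ} (hβ : 0 < β) (hM : 1 ≤ M) (h : M ≤ M'') (hN : 2 * M'' ≤ N) (μ : ℝ) (K : TrigPolyC4v)
    {Λ : ℝ} (hΛ : 0 < Λ) (hΛle : Λ ≤ Real.pi * (2 * M + 1) / β) (X : GridLeg (GridPoint L N)) :
    ∑ Y : GridLeg (GridPoint L N), ‖((hubbardGridSub L M'' β N).transpose * hubbardCovShellCT L h β μ 0 K Λ * hubbardGridSub L M'' β N) X Y‖ ≤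
      (N : ℝ) / (Real.pi * Real.sqrt (2 * M)) + (N : ℝ) * β * (4 + |μ| + K.coeffNorm 0) / (2 * Real.pi ^ 2 * M) +
        (N : ℝ) * (L : ℝ) ^ 2 * (4 + |μ| + K.coeffNorm 0) ^ 2 * β ^ 2 / (2 * Real.pi ^ 3 * M * (2 * M + 1)) := by
  rw [hubbardCovShellCT_zero_seed]
  exact sum_norm_gridSub_pullback_row_le hβ.ne' hN _ (fun σ => sum_sum_norm_charSum_shellSymbolCT_le hβ hM h hN μ K hΛ hΛle σ) X

/-- **Column sums of the shell covariance on the time grid** (`hcol`). [cite: PedraSalmhofer2008, §5 Lemma 5.2] -/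
theorem colSum_gridSub_hubbardCovShellCT_le {β : ℝ} (hβ : 0 < β) (hM : 1 ≤ M) (h : M ≤ M'') (hN : 2 * M'' ≤ N) (μ : ℝ) (K : TrigPolyC4v)
    {Λ : ℝ} (hΛ : 0 < Λ) (hΛle : Λ ≤ Real.pi * (2 * M + 1) / β) (Y : GridLeg (GridPoint L N)) :
    ∑ X : GridLeg (GridPoint L N), ‖((hubbardGridSub L M'' β N).transpose * hubbardCovShellCT L h β μ 0 K Λ * hubbardGridSub L M'' β N) X Y‖ ≤
      (N : ℝ) / (Real.pi * Real.sqrt (2 * M)) + (N : ℝ) * β * (4 + |μ| + K.coeffNorm 0) / (2 * Real.pi ^ 2 * M) +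
        (N : ℝ) * (L : ℝ) ^ 2 * (4 + |μ| + K.coeffNorm 0) ^ 2 * β ^ 2 / (2 * Real.pi ^ 3 * M * (2 * M + 1)) := by
  rw [hubbardCovShellCT_zero_seed]
  exact sum_norm_gridSub_pullback_col_le hβ.ne' hN _ (fun σ => sum_sum_norm_charSum_shellSymbolCT_le hβ hM h hN μ K hΛ hΛle σ) Y

/-- **The decay constant of the shell against the grid weight**: `(β/N)·Σ_Y ‖(SᵀSS)(X,Y)‖ ≤ β/(π√(2M)) + β²c_e/(2π²M) + β³L²c_e²/(2π³M(2M+1))`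
— `O(β/√M)`, uniform in the outer cutoff `M″`; at `M ≥ 2¹⁰β²L²` every term is `O(1/L)`. [cite: PedraSalmhofer2008, §5 Lemma 5.2] -/
theorem gridWeight_mul_rowSum_hubbardCovShellCT_le {β : ℝ} (hβ : 0 < β) (hM : 1 ≤ M) (h : M ≤ M'') (hN : 2 * M'' ≤ N) (μ : ℝ)
    (K : TrigPolyC4v) {Λ : ℝ} (hΛ : 0 < Λ) (hΛle : Λ ≤ Real.pi * (2 * M + 1) / β) (X : GridLeg (GridPoint L N)) :
    β / N * ∑ Y : GridLeg (GridPoint L N),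
        ‖((hubbardGridSub L M'' β N).transpose * hubbardCovShellCT L h β μ 0 K Λ * hubbardGridSub L M'' β N) X Y‖ ≤
      β / (Real.pi * Real.sqrt (2 * M)) + β ^ 2 * (4 + |μ| + K.coeffNorm 0) / (2 * Real.pi ^ 2 * M) +
        β ^ 3 * (L : ℝ) ^ 2 * (4 + |μ| + K.coeffNorm 0) ^ 2 / (2 * Real.pi ^ 3 * M * (2 * M + 1)) := by
  have hN0 : (0 : ℝ) < N := by exact_mod_cast Nat.pos_of_ne_zero (NeZero.ne N)
  refine (mul_le_mul_of_nonneg_left (rowSum_gridSub_hubbardCovShellCT_le hβ hM h hN μ K hΛ hΛle X) (by positivity)).trans (le_of_eq ?_)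
  field_simp

end Literature.MathematicalPhysics.QuantumLattice
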